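import Summits.AtomisticToContinuum.Crystallization.Theorems.ChartedZeroExcessLayeredLatticeLiouvilleYY
import Summits.AtomisticToContinuum.Crystallization.Theorems.ChartedZeroExcessLayeredLatticeLiouvilleYP

/-!
(SPLIT FOR THE 400-LINE CAP by the landing lane, hand-2 g35: this file = part 1 of 2; sequels `…ChartedZeroExcessLayeredLatticeLiouvilleYZ` import it in a chain; same namespace, all FQNs unchanged.)
# Part YZ «CoolShellDichotomy» (lens-2 g74): the existence leaf (XR♮) cut by the TAMENESS CLASS of the sites it must fill — pieces (SC) / (CM)

Docket `stmt-AtomisticToContinuum-26636` (N = `…Theses.ChartedPlanarOrder.ChartedZeroExcessLayered`), cell decomp-a2c RESIDUAL MODE, lens-2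
«structural dichotomy (special vs generic)», generation 74.  Imports parts YY (g73 «ShadowChain»; with YX the line of record 73S, critic row 1312) and
YP (g68, `IsTameStarR`, `isTameStar_tube_of_reference`).  TARGET OF THIS GENERATION: the ∃-leaf (XR♮) `ShadowReferenceP` of 73S — forecast in NODE 73
§4 as the sequential cut (J) frame / (W) word / (M) matching.  0 sorry.

## The lens, this time applied to the SITES THE REFERENCE MUST SERVE (not to configurations, not to references)
(XR♮) asks for ONE object doing two jobs: a placed perfect crystal that (a) SHADOWS the chart and is `ε`-REGISTERED to the cold collar, and (b) FILLS the
core, matched to the core atoms within `dm − dB`.  The sites involved fall into two classes by the TAMENESS CLASS of the atoms around them —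
EXHAUSTIVELY and trivially (`coreOf_subset_moat_union_ball`, PROVED): the COOL SHELL `r < dist(·, K) < ℓ` (every atom `ϑc`-tame: the SPECIAL / rigid /
low-complexity class) and the LOOSE BALL `dist(·, K) ≤ r` (atoms only `ϑp`-tame, `ϑp = 1/10`: the GENERIC class).
* SPECIAL class ⇒ STRUCTURE THEOREM = piece **(SC) `CoolZoneShadowCrystalP`**: the cool shell is, within `ε`, ONE placed `σ`-separated layered crystal
  whose `Rs`-environments two-sidedly `ϑr`-shadow the chart crystal, with TWO-SIDED registration (atoms ↦ sites from `dist > r`, sites ↦ atoms from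
  `dist > rI`).  Mechanism: discrete F. John synthesis of the overlapping `ϑc`-tame stars over a simply connected thick shell.  KINEMATIC · ATTACKABLE.
* GENERIC class ⇒ ESTIMATE = piece **(CM) `MildCoreFillingP`**: GIVEN any such crystal (the structure theorem's output as a hypothesis), the core atoms
  are matched INJECTIVELY to its sites within `d`, and every site within `ρf` of `K` is used.  Mechanism: bounded-depth continuation of the registration
  through `≤ 12` bonded steps of `ϑp`-tame stars (drift `≲ (ϑp/4)·r`) + a COUNT (clean, hard-core atoms in a ball are exactly as many as crystal sites).
  KINEMATIC + COUNTING · UNDECIDED (census «MildDrift-T»).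
* JUNCTION **(XR♮) ⟸ (SC) ∧ (CM)** (`shadowReferenceP_of_coolShell_mildCore`, PROVED, every dial symbolic): `X′ := C ∖ range y₀`; the placed-shadow-patch
  clause is (SC) read at radius `4 ≤ Rs`; collar registration (M1)/(M2)/(S1)/(S2) is REG-out/REG-in plus two UNIQUENESS facts (a crystal site `ε`-close to an
  exterior atom is not a reference site — hard core `27/32` of door sets, `isSep_of_isDoorSetP`; an atom `ε`-close to a non-reference site is exterior —
  `σ`-separation of `C` and occupancy); the tube clause is the TAMENESS TRANSFER `isTameStarR_of_shadow_registered` (PROVED here: shadow + registration ⇒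
  the reference's `(4 + 2dB)`-stars are `(ϑr + ε)`-tame) fed into part YP's `isTameStar_tube_of_reference`, with injectivity (`2dB < σ`), exterior
  avoidance (exterior atoms stay `≥ σ − ε > dI` from reference sites) and matching (`d + dB ≤ dm`) of tube members.
So after this generation EVERY leaf of the 26636 existence line is either configuration-free crystal physics ((X1), (Gl♮)), forward ((Gp♮), (Gs)),
a rigidity statement about `ϑc`-tame shells ((SC), (Rn), (Rt)) or the ONE remaining statement about the loose ball ((CM)) — the dichotomy has pushed all
that is not rigid-or-perfect into a ball of radius `r = 8` and a matching radius.

## Typing decisions (and the three nearby typings NOT taken)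
(1) The crystal is carried as DATA `(L′, w′, U, t)` with `C = {c | U (c − t) ∈ LayeredHom L′ w′}` and `U` PROPER (`det U = 1`): `IsTameStar` demands a
proper rotation, and reading placed bonds in crystal coordinates is `U (c − c′) = U (c − t) − U (c′ − t)` (`placed_bond`) — no inverse determinant is ever
needed.  (2) (CM) takes (SC)'s conclusion `IsCoolShadowCrystal …` as a HYPOTHESIS and pins `y₀` to THAT crystal: the alternative «(CM) produces its own
crystal» would duplicate (SC) and make the junction compare two crystals (a registry-slip statement — exactly g71's dead (Gr) line).  (3) Registration is
TWO-sided and ZONED by `dist(·, K)` with three radii `r ≤ rI ≤ ρf < ρ`: one-sided registration cannot give (M2)/(S1) (a vacant crystal site in the zone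
would be an unmatched `X′`-site), and the inner rims differ because a crystal site at `dist ≈ r` from `K` is surrounded by LOOSE atoms (no `ε`-registration
can be asked there) while occupancy inside `ρf = ρ − 2ε` is what turns «site `ε`-close to a core atom» into «site used».  (4) The shadow radius is a dial
`Rs ≥ 4 + 2dB + ε` (forecast `5`), not (XR♮)'s `4`: tube members see `(4 + 2dB)`-stars of the reference (part YP), read through an `ε`-registration.
NOT taken: «(SC) with `IsClean`/Nash of the crystal» (F18 and row 1303: analytic burden in a kinematic piece); «(CM) with matching radius `dm`» (the tube
eats `dB` of it: `d = dm − dB` is forced by `dist_matched_of_mem_bondTube`); «registration on `dist < r + rsh` only» (reference stars at `dist ≤ ρ + d`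
see exterior atoms out to `ρ + d + 4 + 2dB = 20.8 > 20`: the zone must reach `ℓ > ρ + d + max(Rg, 4 + 2dB)`, forecast `ℓ = 43/2`, still inside the reach
`r + rsh + 4 = 24` of the moat stars).

## Dials and the forecast instance (`shadowReferenceP_instance_of_coolShell_mildCore`, PROVED)
`(σ, ϑr, Rs, ε, rI, ℓ, ρf, d) = (3/4, 10⁻⁴, 5, 10⁻⁴, 10, 43/2, 79999/5000, 1/5)` gives (XR♮) at the record tube `(Rg, sb, dI, dB) = (5, 3/400, 3/400, 3/10)`,
band `[19/4, 21/4]`, `(σ, ϑr, ε) = (3/4, 10⁻⁴, 10⁻⁴)` and reference tameness `ϑ₀ = 1/5000 = ϑr + ε` (the junction FORCES `ϑ₀ ≥ ϑr + ε`; 73S's probe literal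
`ϑ₀ = 10⁻⁴` is not reachable at `ϑr = ε = 10⁻⁴` — harmless: `ϑ₀` is free in the slot and enters only `ϑ₀ + max(sb, dI) ≤ ϑ = 1/100`).  MARGINS: (CM)'s
`d = 1/5` against the adversarial loose-ball drift `(ϑp/4)·r = 1/5` is the ONE tight budget of the node (canary F9); the trade `dB = 1/10 ⇒ d = 2/5` is
available on the (Gl♮)/(Res) side (bulk row × load `≈ 25·10⁻⁴ ≪ 1/10`).  (SC)'s `ε = 10⁻⁴ ≈ 10ϑc` sits at the John constant `(ϑc/4)·diam ≈ 8ϑc`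
(`ϑc` is the `∃ ϑm` of the column: free to lower).

## What is NOT claimed
(SC) and (CM) are not consequences of (XR♮) ((XR♮)'s crystal need not be registered out to `ℓ`, nor in-registered, nor proper as DATA; its `y₀` is not
pinned to a given crystal) — the cut is a sufficient decomposition, as every node of this lens; `matched_of_shadowReferenceP` (PROVED) records the part
of (CM)'s conclusion that (XR♮) does give back (injective, exterior-avoiding, `dm`-matched).  Neither piece is known to imply 26636 or (QE): (SC) speaks of
the collar only, (CM) of positions only (no tube member is tame by (CM), no equation is solved by either).

## Sources
parts YX/YY (g73, critic row 1312: (XR♮), `IsPlacedShadowPatch`, the (J)/(W)/(M) forecast), YO/YOA/YP (g68: `IsTubeReference`, `bondTube`,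
`IsTameStarR`, `isTameStar_tube_of_reference`, `dist_matched_of_mem_bondTube`), YV (`IsCollarRegistered`), UC (`IsTameStar`), UG/UH (`moatIn`, `coreOf`),
TF (`isSep_of_isClean`), CleanScaleP (`IsDoorSetP`, `isCleanP_mono`), MesoCut (`EnvClose`, `LayeredHom`); F. John, CPAM 14 (1961) 391–413;
Friesecke–James–Müller, CPAM 55 (2002) Thm 3.1; B. Schmidt, NHM 4 (2009) 789–812; Conway–Sloane SPLAG ch. 7; E–Ming, ARMA 183 (2007) §2; NODE-g73 §4;
CRITIC-LEDGER rows 1237, 1303, 1312.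
-/

noncomputable section
open scoped BigOperators Classical InnerProductSpace RealInnerProductSpace
open MeasureTheory Set Metric Filter Topology
open Summit.AtomisticToContinuum.Crystallization.Theorems.ChartedPlanarOrderRigidityDoor (E3 IsClean)
open Summit.AtomisticToContinuum.Crystallization.Theorems.ChartedPlanarOrderDensityDichotomy (μS IsSep)
open Summit.AtomisticToContinuum.Crystallization.Theorems.ChartedPlanarOrderCleanScaleP (IsCleanP IsDoorSetP isCleanP_one_iff isCleanP_mono)
open Summit.AtomisticToContinuum.Crystallization.Theorems.ChartedPlanarOrderMesoCut (LayeredHom EnvClose)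
open Summit.AtomisticToContinuum.Crystallization.Theorems.ChartedPlanarOrderDoorLayeredOsc (IsTwoShellAffineGood)
open Literature.MathematicalPhysics.StatisticalMechanics (lennardJones)

namespace Summit.AtomisticToContinuum.Crystallization.Theorems.ChartedZeroExcessLayeredLatticeLiouville

/-! ### YZ-1  Placed crystals, the lens's exhaustion, and small kinematic lemmas (PROVED) -/

section PlacedCrystal

variable {n : ℕ}

/-- **the PLACED crystal** `placedCrystal L′ w′ U t = {c | U (c − t) ∈ LayeredHom L′ w′}`: the rooted layered crystal `H₀ = LayeredHom L′ w′` placed in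
space by the rigid motion `v ↦ U⁻¹ v + t`; `U` (a linear isometry, asked PROPER in (SC)) reads placed coordinates in crystal coordinates, so that a placed
bond `c − c′` is read as the crystal bond `U (c − t) − U (c′ − t)`. [this file, g74] -/
def placedCrystal (L' : E3 →L[ℝ] E3) (w' : ℤ → E3) (U : E3 ≃ₗᵢ[ℝ] E3) (t : E3) : Set E3 :=
  {c | U (c - t) ∈ LayeredHom L' w'}

/-- the placed crystal is the image of `H₀` under the isometry `v ↦ U⁻¹ v + t`. [this file, g74] -/
theorem placedCrystal_eq_image (L' : E3 →L[ℝ] E3) (w' : ℤ → E3) (U : E3 ≃ₗᵢ[ℝ] E3) (t : E3) :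
    placedCrystal L' w' U t = (fun v => U.symm v + t) '' LayeredHom L' w' := by
  ext c
  constructor
  · intro hc
    exact ⟨U (c - t), hc, by simp⟩
  · rintro ⟨v, hv, rfl⟩
    show U (U.symm v + t - t) ∈ LayeredHom L' w'
    simpa using hv

/-- `v ↦ U⁻¹ v + t` is an isometry. [folklore] -/
theorem isometry_unplace (U : E3 ≃ₗᵢ[ℝ] E3) (t : E3) : Isometry (fun v : E3 => U.symm v + t) :=
  Isometry.of_dist_eq fun a b => by rw [dist_add_right, U.symm.dist_map]

/-- a placed copy of a `σ`-separated crystal is `σ`-separated. [this file, g74] -/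
theorem isSep_placedCrystal {σ : ℝ} {L' : E3 →L[ℝ] E3} {w' : ℤ → E3} (U : E3 ≃ₗᵢ[ℝ] E3) (t : E3)
    (h : IsSep σ (LayeredHom L' w')) : IsSep σ (placedCrystal L' w' U t) := by
  intro c hc c' hc' hne
  have hne' : U (c - t) ≠ U (c' - t) := fun h' => hne (by simpa using U.injective h')
  have key := h _ hc _ hc' hne'
  rwa [U.dist_map, dist_sub_right] at key

/-- a placed bond read in crystal coordinates. [this file, g74] -/
theorem placed_bond (U : E3 ≃ₗᵢ[ℝ] E3) (t c c' : E3) : U (c - c') = U (c - t) - U (c' - t) := by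
  rw [← map_sub, sub_sub_sub_cancel_right]

/-- `EnvClose` is ANTITONE in the radius (a larger environment matched ⇒ the smaller one is). [this file, g74] -/
theorem envClose_of_radius_le {τ r r' : ℝ} (h : r ≤ r') {S : Set E3} {x : E3} {H : Set E3} {y : E3} (hE : EnvClose τ r' S x H y) :
    EnvClose τ r S x H y :=
  ⟨fun p hp hd => hE.1 p hp (hd.trans h), fun q hq hd => hE.2 q hq (hd.trans h)⟩

/-- the HARD CORE of a door set (`aHi ≤ 1`): `27/32`-separated, by cleanliness (`isSep_of_isClean`). [this file, g74] -/
theorem isSep_of_isDoorSetP {aHi δ : ℝ} {S : Set E3} (haHi : aHi ≤ 1) (hS : IsDoorSetP aHi δ S) : IsSep (27 / 32) S :=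
  isSep_of_isClean ((isCleanP_one_iff _).1 (isCleanP_mono haHi hS.2.2.1))

/-- ★ **LENS EXHAUSTION (PROVED, trivial)**: every site of the `ρ`-core is EITHER a COOL-SHELL site (`r < dist(·, k)` for all `k ∈ K`, hence in the moat
`moatIn S K r ℓ` once `ρ < ℓ` — the SPECIAL / rigid class, `ϑc`-tame) OR a LOOSE-BALL site (`dist(·, k) ≤ r` for some `k ∈ K` — the GENERIC class, only
`ϑp`-tame).  The two pieces (SC) / (CM) below own one class each. [this file, g74] -/
theorem coreOf_subset_moat_union_ball {S K : Set E3} {r ρ ℓ : ℝ} (hρ : ρ < ℓ) :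
    coreOf S K ρ ⊆ moatIn S K r ℓ ∪ {p | p ∈ S ∧ ∃ k ∈ K, dist p k ≤ r} := by
  rintro p ⟨hpS, k, hk, hpk⟩
  by_cases h : ∃ k ∈ K, dist p k ≤ r
  · exact Or.inr ⟨hpS, h⟩
  · push Not at h
    exact Or.inl ⟨hpS, ⟨k, hk, by linarith⟩, h⟩

/-- in a bond tube over a `σ`-separated reference with `2·dB < σ`, every member is injective. [this file, g74] -/
theorem injective_of_mem_bondTube_of_sep {σ Rg sb dI dB : ℝ} {X : Set E3} {y₀ z : Fin n → E3}
    (hsep : ∀ i j, i ≠ j → σ ≤ dist (y₀ i) (y₀ j)) (h2 : 2 * dB < σ) (hz : z ∈ bondTube X Rg sb dI dB y₀) :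
    Function.Injective z := by
  intro i j hij
  by_contra hne
  have h1 : dist (z i) (y₀ i) ≤ dB := hz.2.2 i
  have h2' : dist (z j) (y₀ j) ≤ dB := hz.2.2 j
  have h1' : dist (y₀ i) (z j) ≤ dB := by rw [← hij, dist_comm]; exact h1
  have := hsep i j hne
  have : dist (y₀ i) (y₀ j) ≤ dB + dB :=
    calc dist (y₀ i) (y₀ j) ≤ dist (y₀ i) (z j) + dist (z j) (y₀ j) := dist_triangle _ _ _
      _ ≤ dB + dB := add_le_add h1' h2'
  linarith

/-- in a bond tube whose reference keeps every exterior atom within `Rg` at distance `> dI` (and `dB ≤ Rg`), every member avoids the exterior.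
[this file, g74] -/
theorem disjoint_of_mem_bondTube_of_far {Rg sb dI dB : ℝ} {X : Set E3} {y₀ z : Fin n → E3}
    (hfar : ∀ i, ∀ p ∈ X, dist p (y₀ i) ≤ Rg → dI < dist p (y₀ i)) (hdB : dB ≤ Rg) (hz : z ∈ bondTube X Rg sb dI dB y₀) :
    Disjoint (Set.range z) X := by
  refine Set.disjoint_left.2 ?_
  rintro _ ⟨i, rfl⟩ hzX
  have hB : dist (z i) (y₀ i) ≤ dB := hz.2.2 i
  have hI : dist (z i) (y₀ i) ≤ dI := hz.2.1 i ⟨z i, hzX, by rw [dist_comm]; exact hB.trans hdB⟩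
  exact absurd hI (not_le.2 (hfar i (z i) hzX (hB.trans hdB)))

/-- ★★ **TAMENESS TRANSFER (PROVED)** — the reference's extended tameness from SHADOWING + REGISTRATION.  If every site of `y₀` lies on the placed crystal
`C = placedCrystal L′ w′ U t` (`U` proper), every `Rs`-environment of `H₀ = LayeredHom L′ w′` is two-sidedly `ϑr`-shadowed by an environment of `H`, and
every exterior atom within `R′` of `y₀ i` is `ε`-registered to a site of `C` (`R′ + ε ≤ Rs`), then the `R′`-star of `X ∪ range y₀` at `y₀ i` is
`(ϑr + ε)`-tame relative to `H`: rotation `U`, model map = the shadow's `H`-site of (the registering crystal site of) each star point. [this file, g74] -/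
theorem isTameStarR_of_shadow_registered {ϑr Rs ε R' : ℝ} {X H : Set E3} {L' : E3 →L[ℝ] E3} {w' : ℤ → E3} {U : E3 ≃ₗᵢ[ℝ] E3} {t : E3}
    {y₀ : Fin n → E3} (hR : R' + ε ≤ Rs) (hR' : 0 ≤ R') (hε : 0 ≤ ε)
    (hdet : LinearMap.det (U.toLinearEquiv : E3 →ₗ[ℝ] E3) = 1)
    (hsh : ∀ x' ∈ LayeredHom L' w', ∃ x ∈ H, EnvClose ϑr Rs (LayeredHom L' w') x' H x)
    (hy : ∀ j, y₀ j ∈ placedCrystal L' w' U t) (i : Fin n)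
    (hreg : ∀ p ∈ X, dist p (y₀ i) ≤ R' → ∃ c ∈ placedCrystal L' w' U t, dist p c ≤ ε) :
    IsTameStarR R' (ϑr + ε) (X ∪ Set.range y₀) H (y₀ i) := by
  obtain ⟨x, hx, hE⟩ := hsh (U (y₀ i - t)) (hy i)
  have key : ∀ v ∈ LayeredHom L' w', dist v (U (y₀ i - t)) ≤ Rs → ∃ q ∈ H, dist (v - U (y₀ i - t)) (q - x) ≤ ϑr :=
    fun v hv hd => hE.1 v hv hd
  choose! Φ hΦH hΦd using key
  choose! cr hcrC hcrd using hreg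
  have hϑr : 0 ≤ ϑr := by
    have h0 := hΦd (U (y₀ i - t)) (hy i) (by rw [dist_self]; linarith)
    exact le_trans dist_nonneg h0
  -- crystal-coordinate distance of a placed point to the base
  have hcd : ∀ c : E3, dist (U (c - t)) (U (y₀ i - t)) = dist c (y₀ i) := fun c => by rw [U.dist_map, dist_sub_right]
  let g : E3 → E3 := fun p => if p = y₀ i then x else if p ∈ Set.range y₀ then Φ (U (p - t)) else Φ (U (cr p - t))
  have hgi : g (y₀ i) = x := by simp only [g, if_pos rfl]
  refine ⟨U, g, hdet, ?_, ?_⟩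
  · -- the model map sends the `R′`-star into `H`
    rintro p ⟨hp, hpR⟩
    have hpR' : dist p (y₀ i) ≤ R' := hpR
    by_cases hpi : p = y₀ i
    · simp only [g, if_pos hpi]; exact hx
    by_cases hpr : p ∈ Set.range y₀
    · obtain ⟨j, rfl⟩ := hpr
      simp only [g, if_neg hpi, if_pos (Set.mem_range_self j)]
      exact hΦH _ (hy j) (by rw [hcd]; linarith)
    · have hpX : p ∈ X := hp.resolve_right hpr
      simp only [g, if_neg hpi, if_neg hpr]
      refine hΦH _ (hcrC p hpX hpR') ?_
      rw [hcd]
      calc dist (cr p) (y₀ i) ≤ dist (cr p) p + dist p (y₀ i) := dist_triangle _ _ _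
        _ ≤ ε + R' := add_le_add (by rw [dist_comm]; exact hcrd p hpX hpR') hpR'
        _ ≤ Rs := by linarith
  · -- the bond estimates
    intro p hp hpR
    rw [hgi]
    by_cases hpi : p = y₀ i
    · subst hpi
      simp only [g, if_pos rfl, sub_self, map_zero, dist_self]
      linarith
    by_cases hpr : p ∈ Set.range y₀
    · obtain ⟨j, rfl⟩ := hpr
      simp only [g, if_neg hpi, if_pos (Set.mem_range_self j)]
      rw [placed_bond U t]
      exact (hΦd _ (hy j) (by rw [hcd]; linarith)).trans (by linarith)
    · have hpX : p ∈ X := hp.resolve_right hpr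
      simp only [g, if_neg hpi, if_neg hpr]
      have hc : dist (cr p) (y₀ i) ≤ Rs :=
        calc dist (cr p) (y₀ i) ≤ dist (cr p) p + dist p (y₀ i) := dist_triangle _ _ _
          _ ≤ ε + R' := add_le_add (by rw [dist_comm]; exact hcrd p hpX hpR) hpR
          _ ≤ Rs := by linarith
      have h1 : dist (U (cr p - t) - U (y₀ i - t)) (Φ (U (cr p - t)) - x) ≤ ϑr := hΦd _ (hcrC p hpX hpR) (by rw [hcd]; exact hc)
      calc dist (U (p - y₀ i)) (Φ (U (cr p - t)) - x)
          ≤ dist (U (p - y₀ i)) (U (cr p - y₀ i)) + dist (U (cr p - y₀ i)) (Φ (U (cr p - t)) - x) := dist_triangle _ _ _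
        _ = dist p (cr p) + dist (U (cr p - t) - U (y₀ i - t)) (Φ (U (cr p - t)) - x) := by
            rw [U.dist_map, dist_sub_right, placed_bond U t]
        _ ≤ ε + ϑr := add_le_add (hcrd p hpX hpR) h1
        _ = ϑr + ε := add_comm _ _

end PlacedCrystal

end Summit.AtomisticToContinuum.Crystallization.Theorems.ChartedZeroExcessLayeredLatticeLiouville

end
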